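import Mathlib
import HarnessLib
import Summits.NavierStokesRegularity.NavierStokesRegularity.Theorems.PoloidalWindowDoorPoloidalWindowRigidityK2OfLrcSlope

/-!
# Crux `PoloidalWindowRigidity` (K2, stmt-NavierStokesRegularity-19708) — negative side: an explicit ELEMENTARY frozen THICK twisting hyperbolic
# poloidal germ (the «log-twist germ»): the kinematic hypotheses of the local THICK statements are jointly satisfiable

Cell ns-regularity-ideate, seat ns-poloidal-K2-p4 gen 0 (THICK column; lead ns-poloidal-K2-p2; `--supports stmt-NavierStokesRegularity-19708` helper,
negative side).  The THICK column of crux 19708 / item 20428 is reduced (this seat: `…HyperbolicThickOfLocalOpen`, `…LrcModEntireTwistingThickOfLocalOpen`,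
`…TwistingThickLeafwise`, `…LocalThickTHOfLocalOpen`) to ONE local statement `hthick`/`hleaf`/S2 about real-analytic classical NS germs.  refuter1 K-48/K-49
found the same system WITHOUT the momentum clause numerically inhabited (j291279) but «no closed form ⇒ no Lean witness».  HERE IS A CLOSED FORM:

  `V(x,y,z) = ( x² − xz + z²/2 + log((x−z)² + y²),  −yz + 2·arctan((x−z)/y),  (x−z)² + y² )`   on the half-space `{y > 0}`

(from the ansatz `w = F(x − cz, y)` with an autonomous structure function `∂_zφ = G(w)`: (K1) `w_zz + Δₕ[G(w)] = 0` with `F` radial forces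
`2wG″ + 2G′ + c² = 0`, i.e. `G′(w) = −c²/2 + d/(2w)`; here `c = 1`, `κ = 2`, `d = −2`, and the potential is elementary — `∫ G′(w)∇ₕw dz` gives the
`log` and the `arctan`).  At EVERY point of `{y > 0}` (exact elementary calculus, `r² := (x−z)² + y²`):
* divergence-free and POLOIDAL along `e₃` (`∂₀V₁ = ∂₁V₀ = 2y/r²`);
* FROZEN, `∂₂V_h = Λ∇ₕV₂` with shear ratio `Λ = −1/2 − 1/r²`: THICK (`∂₁Λ = 2y/r⁴ ≠ 0`; leafwise `∇ₕΛ ∥ ∇ₕV₂`; `∂ₙΛ = 4/r² ≠ 0`) and HYPERBOLIC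
  (`⟪∂₂V_h, ∇ₕV₂⟫ = −2r² − 4 < 0`);
* non-degenerate (`(curl V)₀ = y(3 + 2/r²)`, `∂₁V₂ = 2y`, `∂₂V₁ = −y(1 + 2/r²)`, all `≠ 0`) and TWISTING (`∂₀(∂₂V₂)·∂₁V₂ − ∂₁(∂₂V₂)·∂₀V₂ = −4y ≠ 0`);
* real-analytic (polynomials, `log` on `(0,∞)`, `arctan`); time–height on NO open subset (the would-be slope `m(t,y₂) = Λ` differs at two points of
  equal height on a horizontal `e₁`-segment).
`logTwistGerm_hypotheses` packages this as ONE existential statement in exactly the vocabulary of the local statements (steady germ `u t := V` on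
`U = ℝ × {y > 0}`); its sibling `…LogTwistGermFalseWithoutMomentum` reads off that `hthick`, `hleaf` and S2 `stub_localThickTH` are FALSE once their
momentum clause is deleted.  The germ is NOT a Navier–Stokes solution for any pressure (vertical momentum residual with `log`/`arctan` terms, kit
j292380 — not claimed in the kernel), steady and unbounded: it says nothing about the class stubs; it is a TEST GERM for every thick certificate.
WHAT THIS IS NOT: not a claim about Navier–Stokes regularity, not a refutation of any registered stub. [folklore calculus]
-/

noncomputable section

-- the summit and its single sub-problem share the name (CONVENTIONS §1), as in every Theorems file
set_option linter.dupNamespace false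

namespace Summit.NavierStokesRegularity.NavierStokesRegularity.Theorems.PoloidalWindowRigidity.Negative.LogTwistGerm

open Set Function Filter Topology Metric
open scoped RealInnerProductSpace InnerProductSpace
open Literature.Analysis Literature.Analysis.FluidPDE
open Summit.NavierStokesRegularity.NavierStokesRegularity.Theorems.PoloidalWindowDoorPoloidalWindowRigidityProportionalShear
open Summit.NavierStokesRegularity.NavierStokesRegularity.Theorems.PoloidalWindowDoorPoloidalWindowRigidityK2OfLrcSlope

/-! ### Calculus of the germ on `{y > 0}` -/

/-- `r² = (x−z)² + y²` has derivative `w ↦ 2(x−z)(w₀−w₂) + 2yw₁`. -/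
theorem hasFDerivAt_rsq (p : EuclideanSpace ℝ (Fin 3)) :
    HasFDerivAt (fun y : EuclideanSpace ℝ (Fin 3) => (y 0 - y 2) * (y 0 - y 2) + y 1 * y 1)
      ((p 0 - p 2) • ((EuclideanSpace.proj (𝕜 := ℝ) (0 : Fin 3) : EuclideanSpace ℝ (Fin 3) →L[ℝ] ℝ) - (EuclideanSpace.proj (𝕜 := ℝ) (2 : Fin 3) : EuclideanSpace ℝ (Fin 3) →L[ℝ] ℝ)) +
        (p 0 - p 2) • ((EuclideanSpace.proj (𝕜 := ℝ) (0 : Fin 3) : EuclideanSpace ℝ (Fin 3) →L[ℝ] ℝ) - (EuclideanSpace.proj (𝕜 := ℝ) (2 : Fin 3) : EuclideanSpace ℝ (Fin 3) →L[ℝ] ℝ)) +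
        ((p 1) • (EuclideanSpace.proj (𝕜 := ℝ) (1 : Fin 3) : EuclideanSpace ℝ (Fin 3) →L[ℝ] ℝ) + (p 1) • (EuclideanSpace.proj (𝕜 := ℝ) (1 : Fin 3) : EuclideanSpace ℝ (Fin 3) →L[ℝ] ℝ))) p :=
  ((((EuclideanSpace.proj (𝕜 := ℝ) (0 : Fin 3) : EuclideanSpace ℝ (Fin 3) →L[ℝ] ℝ).hasFDerivAt).sub ((EuclideanSpace.proj (𝕜 := ℝ) (2 : Fin 3) : EuclideanSpace ℝ (Fin 3) →L[ℝ] ℝ).hasFDerivAt)).mul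
    (((EuclideanSpace.proj (𝕜 := ℝ) (0 : Fin 3) : EuclideanSpace ℝ (Fin 3) →L[ℝ] ℝ).hasFDerivAt).sub ((EuclideanSpace.proj (𝕜 := ℝ) (2 : Fin 3) : EuclideanSpace ℝ (Fin 3) →L[ℝ] ℝ).hasFDerivAt))).add
    (((EuclideanSpace.proj (𝕜 := ℝ) (1 : Fin 3) : EuclideanSpace ℝ (Fin 3) →L[ℝ] ℝ).hasFDerivAt).mul ((EuclideanSpace.proj (𝕜 := ℝ) (1 : Fin 3) : EuclideanSpace ℝ (Fin 3) →L[ℝ] ℝ).hasFDerivAt))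

/-- **The log-twist germ: derivative componentwise and the nine Jacobian entries** on `{y > 0}`. -/
theorem entries (V : EuclideanSpace ℝ (Fin 3) → EuclideanSpace ℝ (Fin 3))
    (hV : V = fun p : EuclideanSpace ℝ (Fin 3) =>
      (p 0 * p 0 - p 0 * p 2 + 2⁻¹ * (p 2 * p 2) + Real.log ((p 0 - p 2) * (p 0 - p 2) + p 1 * p 1)) • EuclideanSpace.single (0 : Fin 3) (1 : ℝ) +
        (-(p 1 * p 2) + 2 * Real.arctan ((p 0 - p 2) * (p 1)⁻¹)) • EuclideanSpace.single (1 : Fin 3) (1 : ℝ) +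
        ((p 0 - p 2) * (p 0 - p 2) + p 1 * p 1) • EuclideanSpace.single (2 : Fin 3) (1 : ℝ)) {p : EuclideanSpace ℝ (Fin 3)} (hp : 0 < p 1) :
    DifferentiableAt ℝ V p ∧
    fderiv ℝ V p (EuclideanSpace.single 0 1) 0 = 2 * p 0 - p 2 + 2 * (p 0 - p 2) / ((p 0 - p 2) * (p 0 - p 2) + p 1 * p 1) ∧
    fderiv ℝ V p (EuclideanSpace.single 1 1) 0 = 2 * p 1 / ((p 0 - p 2) * (p 0 - p 2) + p 1 * p 1) ∧
    fderiv ℝ V p (EuclideanSpace.single 2 1) 0 = -(p 0) + p 2 - 2 * (p 0 - p 2) / ((p 0 - p 2) * (p 0 - p 2) + p 1 * p 1) ∧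
    fderiv ℝ V p (EuclideanSpace.single 0 1) 1 = 2 * p 1 / ((p 0 - p 2) * (p 0 - p 2) + p 1 * p 1) ∧
    fderiv ℝ V p (EuclideanSpace.single 1 1) 1 = -(p 2) - 2 * (p 0 - p 2) / ((p 0 - p 2) * (p 0 - p 2) + p 1 * p 1) ∧
    fderiv ℝ V p (EuclideanSpace.single 2 1) 1 = -(p 1) - 2 * p 1 / ((p 0 - p 2) * (p 0 - p 2) + p 1 * p 1) ∧
    fderiv ℝ V p (EuclideanSpace.single 0 1) 2 = 2 * (p 0 - p 2) ∧
    fderiv ℝ V p (EuclideanSpace.single 1 1) 2 = 2 * p 1 ∧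
    fderiv ℝ V p (EuclideanSpace.single 2 1) 2 = -(2 * (p 0 - p 2)) := by
  subst hV
  set π0 : EuclideanSpace ℝ (Fin 3) →L[ℝ] ℝ := (EuclideanSpace.proj (𝕜 := ℝ) (0 : Fin 3) : EuclideanSpace ℝ (Fin 3) →L[ℝ] ℝ) with hπ0
  set π1 : EuclideanSpace ℝ (Fin 3) →L[ℝ] ℝ := (EuclideanSpace.proj (𝕜 := ℝ) (1 : Fin 3) : EuclideanSpace ℝ (Fin 3) →L[ℝ] ℝ) with hπ1
  set π2 : EuclideanSpace ℝ (Fin 3) →L[ℝ] ℝ := (EuclideanSpace.proj (𝕜 := ℝ) (2 : Fin 3) : EuclideanSpace ℝ (Fin 3) →L[ℝ] ℝ) with hπ2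
  have hc0 : HasFDerivAt (fun y : EuclideanSpace ℝ (Fin 3) => y 0) π0 p := π0.hasFDerivAt
  have hc1 : HasFDerivAt (fun y : EuclideanSpace ℝ (Fin 3) => y 1) π1 p := π1.hasFDerivAt
  have hc2 : HasFDerivAt (fun y : EuclideanSpace ℝ (Fin 3) => y 2) π2 p := π2.hasFDerivAt
  have hy : p 1 ≠ 0 := ne_of_gt hp
  have hr : 0 < ((p 0 - p 2) * (p 0 - p 2) + p 1 * p 1) := by
    have : 0 < p 1 * p 1 := by positivity
    nlinarith [mul_self_nonneg (p 0 - p 2)]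
  have hr0 : ((p 0 - p 2) * (p 0 - p 2) + p 1 * p 1) ≠ 0 := ne_of_gt hr
  have hDR := hasFDerivAt_rsq p
  have hlog := (Real.hasDerivAt_log hr0).comp_hasFDerivAt p hDR
  have H0 := ((((hc0.mul hc0).sub (hc0.mul hc2)).add ((hc2.mul hc2).const_mul 2⁻¹))).add hlog
  have hinv := (hasDerivAt_inv hy).comp_hasFDerivAt p hc1
  have hq := (hc0.sub hc2).mul hinv
  have hat := (Real.hasDerivAt_arctan ((p 0 - p 2) * (p 1)⁻¹)).comp_hasFDerivAt p hq
  have H1 := ((hc1.mul hc2).neg).add (hat.const_mul 2)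
  have H := ((H0.smul_const (EuclideanSpace.single (0 : Fin 3) (1 : ℝ) : EuclideanSpace ℝ (Fin 3))).add
    (H1.smul_const (EuclideanSpace.single (1 : Fin 3) (1 : ℝ) : EuclideanSpace ℝ (Fin 3)))).add
    (hDR.smul_const (EuclideanSpace.single (2 : Fin 3) (1 : ℝ) : EuclideanSpace ℝ (Fin 3)))
  have hden : (1 + ((p 0 - p 2) * (p 1)⁻¹) ^ 2) = ((p 0 - p 2) * (p 0 - p 2) + p 1 * p 1) * (p 1 ^ 2)⁻¹ := by
    field_simp; ring
  -- the derivative applied to a vector, componentwise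
  have hw : ∀ w : EuclideanSpace ℝ (Fin 3),
      fderiv ℝ (fun p : EuclideanSpace ℝ (Fin 3) =>
      (p 0 * p 0 - p 0 * p 2 + 2⁻¹ * (p 2 * p 2) + Real.log ((p 0 - p 2) * (p 0 - p 2) + p 1 * p 1)) • EuclideanSpace.single (0 : Fin 3) (1 : ℝ) +
        (-(p 1 * p 2) + 2 * Real.arctan ((p 0 - p 2) * (p 1)⁻¹)) • EuclideanSpace.single (1 : Fin 3) (1 : ℝ) +
        ((p 0 - p 2) * (p 0 - p 2) + p 1 * p 1) • EuclideanSpace.single (2 : Fin 3) (1 : ℝ)) p w 0 = (2 * p 0 - p 2) * w 0 - p 0 * w 2 + p 2 * w 2 +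
          ((p 0 - p 2) * (p 0 - p 2) + p 1 * p 1)⁻¹ * (2 * (p 0 - p 2) * (w 0 - w 2) + 2 * p 1 * w 1) ∧
        fderiv ℝ (fun p : EuclideanSpace ℝ (Fin 3) =>
      (p 0 * p 0 - p 0 * p 2 + 2⁻¹ * (p 2 * p 2) + Real.log ((p 0 - p 2) * (p 0 - p 2) + p 1 * p 1)) • EuclideanSpace.single (0 : Fin 3) (1 : ℝ) +
        (-(p 1 * p 2) + 2 * Real.arctan ((p 0 - p 2) * (p 1)⁻¹)) • EuclideanSpace.single (1 : Fin 3) (1 : ℝ) +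
        ((p 0 - p 2) * (p 0 - p 2) + p 1 * p 1) • EuclideanSpace.single (2 : Fin 3) (1 : ℝ)) p w 1 = -(p 2 * w 1 + p 1 * w 2) +
          2 * ((p 0 - p 2) * (p 0 - p 2) + p 1 * p 1)⁻¹ * (p 1 * (w 0 - w 2) - (p 0 - p 2) * w 1) ∧
        fderiv ℝ (fun p : EuclideanSpace ℝ (Fin 3) =>
      (p 0 * p 0 - p 0 * p 2 + 2⁻¹ * (p 2 * p 2) + Real.log ((p 0 - p 2) * (p 0 - p 2) + p 1 * p 1)) • EuclideanSpace.single (0 : Fin 3) (1 : ℝ) +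
        (-(p 1 * p 2) + 2 * Real.arctan ((p 0 - p 2) * (p 1)⁻¹)) • EuclideanSpace.single (1 : Fin 3) (1 : ℝ) +
        ((p 0 - p 2) * (p 0 - p 2) + p 1 * p 1) • EuclideanSpace.single (2 : Fin 3) (1 : ℝ)) p w 2 = 2 * (p 0 - p 2) * (w 0 - w 2) + 2 * p 1 * w 1 := by
    intro w
    have H' : HasFDerivAt (fun p : EuclideanSpace ℝ (Fin 3) =>
      (p 0 * p 0 - p 0 * p 2 + 2⁻¹ * (p 2 * p 2) + Real.log ((p 0 - p 2) * (p 0 - p 2) + p 1 * p 1)) • EuclideanSpace.single (0 : Fin 3) (1 : ℝ) +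
        (-(p 1 * p 2) + 2 * Real.arctan ((p 0 - p 2) * (p 1)⁻¹)) • EuclideanSpace.single (1 : Fin 3) (1 : ℝ) +
        ((p 0 - p 2) * (p 0 - p 2) + p 1 * p 1) • EuclideanSpace.single (2 : Fin 3) (1 : ℝ)) _ p := H
    rw [H'.fderiv]
    refine ⟨?_, ?_, ?_⟩
    · simp [hπ0, hπ1, hπ2]
      ring
    · simp [hπ0, hπ1, hπ2, hden]
      field_simp
      ring
    · simp [hπ0, hπ1, hπ2]
      ring
  have h0 := hw (EuclideanSpace.single 0 1)
  have h1 := hw (EuclideanSpace.single 1 1)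
  have h2 := hw (EuclideanSpace.single 2 1)
  simp only [PiLp.single_apply, if_true, Fin.isValue] at h0 h1 h2
  have H' : HasFDerivAt (fun p : EuclideanSpace ℝ (Fin 3) =>
      (p 0 * p 0 - p 0 * p 2 + 2⁻¹ * (p 2 * p 2) + Real.log ((p 0 - p 2) * (p 0 - p 2) + p 1 * p 1)) • EuclideanSpace.single (0 : Fin 3) (1 : ℝ) +
        (-(p 1 * p 2) + 2 * Real.arctan ((p 0 - p 2) * (p 1)⁻¹)) • EuclideanSpace.single (1 : Fin 3) (1 : ℝ) +
        ((p 0 - p 2) * (p 0 - p 2) + p 1 * p 1) • EuclideanSpace.single (2 : Fin 3) (1 : ℝ)) _ p := H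
  refine ⟨H'.differentiableAt, ?_, ?_, ?_, ?_, ?_, ?_, ?_, ?_, ?_⟩
  · rw [h0.1]; simp; field_simp
  · rw [h1.1]; simp; field_simp
  · rw [h2.1]; simp; field_simp; ring
  · rw [h0.2.1]; simp; field_simp
  · rw [h1.2.1]; simp; field_simp; ring
  · rw [h2.2.1]; simp; field_simp; ring
  · rw [h0.2.2]; simp
  · rw [h1.2.2]; simp
  · rw [h2.2.2]; simp

/-- The half-space `{y > 0}` is open. -/
theorem isOpen_halfspace : IsOpen {y : EuclideanSpace ℝ (Fin 3) | 0 < y 1} :=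
  isOpen_lt continuous_const (EuclideanSpace.proj (𝕜 := ℝ) (1 : Fin 3) : EuclideanSpace ℝ (Fin 3) →L[ℝ] ℝ).continuous

/-- **Twist entries**: `∂₀(∂₂V₂) = −2`, `∂₁(∂₂V₂) = 0` on `{y > 0}`. -/
theorem twist_entries (V : EuclideanSpace ℝ (Fin 3) → EuclideanSpace ℝ (Fin 3))
    (hV : V = fun p : EuclideanSpace ℝ (Fin 3) =>
      (p 0 * p 0 - p 0 * p 2 + 2⁻¹ * (p 2 * p 2) + Real.log ((p 0 - p 2) * (p 0 - p 2) + p 1 * p 1)) • EuclideanSpace.single (0 : Fin 3) (1 : ℝ) +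
        (-(p 1 * p 2) + 2 * Real.arctan ((p 0 - p 2) * (p 1)⁻¹)) • EuclideanSpace.single (1 : Fin 3) (1 : ℝ) +
        ((p 0 - p 2) * (p 0 - p 2) + p 1 * p 1) • EuclideanSpace.single (2 : Fin 3) (1 : ℝ)) {p : EuclideanSpace ℝ (Fin 3)} (hp : 0 < p 1) :
    fderiv ℝ (fun y => fderiv ℝ V y (EuclideanSpace.single 2 1) 2) p (EuclideanSpace.single 0 1) = -2 ∧
    fderiv ℝ (fun y => fderiv ℝ V y (EuclideanSpace.single 2 1) 2) p (EuclideanSpace.single 1 1) = 0 := by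
  have hev : (fun y : EuclideanSpace ℝ (Fin 3) => fderiv ℝ V y (EuclideanSpace.single 2 1) 2) =ᶠ[𝓝 p]
      fun y => -(2 * (y 0 - y 2)) := by
    filter_upwards [isOpen_halfspace.mem_nhds hp] with y hy
    exact (entries V hV hy).2.2.2.2.2.2.2.2.2
  have hd : HasFDerivAt (fun y : EuclideanSpace ℝ (Fin 3) => -(2 * (y 0 - y 2)))
      (-((2 : ℝ) • ((EuclideanSpace.proj (𝕜 := ℝ) (0 : Fin 3) : EuclideanSpace ℝ (Fin 3) →L[ℝ] ℝ) - (EuclideanSpace.proj (𝕜 := ℝ) (2 : Fin 3) : EuclideanSpace ℝ (Fin 3) →L[ℝ] ℝ)))) p :=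
    ((((EuclideanSpace.proj (𝕜 := ℝ) (0 : Fin 3) : EuclideanSpace ℝ (Fin 3) →L[ℝ] ℝ).hasFDerivAt).sub ((EuclideanSpace.proj (𝕜 := ℝ) (2 : Fin 3) : EuclideanSpace ℝ (Fin 3) →L[ℝ] ℝ).hasFDerivAt)).const_smul (2 : ℝ)).neg
  rw [hev.fderiv_eq, hd.fderiv]
  constructor <;> simp

/-- **The shear ratio `Λ = −1/2 − 1/r²` and its horizontal derivatives** `∂₀Λ = 2(x−z)/r⁴`, `∂₁Λ = 2y/r⁴` on `{y > 0}`. -/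
theorem ratio_entries (V : EuclideanSpace ℝ (Fin 3) → EuclideanSpace ℝ (Fin 3))
    (hV : V = fun p : EuclideanSpace ℝ (Fin 3) =>
      (p 0 * p 0 - p 0 * p 2 + 2⁻¹ * (p 2 * p 2) + Real.log ((p 0 - p 2) * (p 0 - p 2) + p 1 * p 1)) • EuclideanSpace.single (0 : Fin 3) (1 : ℝ) +
        (-(p 1 * p 2) + 2 * Real.arctan ((p 0 - p 2) * (p 1)⁻¹)) • EuclideanSpace.single (1 : Fin 3) (1 : ℝ) +
        ((p 0 - p 2) * (p 0 - p 2) + p 1 * p 1) • EuclideanSpace.single (2 : Fin 3) (1 : ℝ)) {p : EuclideanSpace ℝ (Fin 3)} (hp : 0 < p 1) :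
    fderiv ℝ (fun y => (fderiv ℝ V y (EuclideanSpace.single 2 1) 0 * fderiv ℝ V y (EuclideanSpace.single 0 1) 2 +
              fderiv ℝ V y (EuclideanSpace.single 2 1) 1 * fderiv ℝ V y (EuclideanSpace.single 1 1) 2) /
            (fderiv ℝ V y (EuclideanSpace.single 0 1) 2 ^ 2 + fderiv ℝ V y (EuclideanSpace.single 1 1) 2 ^ 2)) p (EuclideanSpace.single 0 1) = 2 * (p 0 - p 2) / ((p 0 - p 2) * (p 0 - p 2) + p 1 * p 1) ^ 2 ∧
    fderiv ℝ (fun y => (fderiv ℝ V y (EuclideanSpace.single 2 1) 0 * fderiv ℝ V y (EuclideanSpace.single 0 1) 2 +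
              fderiv ℝ V y (EuclideanSpace.single 2 1) 1 * fderiv ℝ V y (EuclideanSpace.single 1 1) 2) /
            (fderiv ℝ V y (EuclideanSpace.single 0 1) 2 ^ 2 + fderiv ℝ V y (EuclideanSpace.single 1 1) 2 ^ 2)) p (EuclideanSpace.single 1 1) = 2 * p 1 / ((p 0 - p 2) * (p 0 - p 2) + p 1 * p 1) ^ 2 := by
  have hr : 0 < ((p 0 - p 2) * (p 0 - p 2) + p 1 * p 1) := by
    have : 0 < p 1 * p 1 := by positivity
    nlinarith [mul_self_nonneg (p 0 - p 2)]
  have hr0 : ((p 0 - p 2) * (p 0 - p 2) + p 1 * p 1) ≠ 0 := ne_of_gt hr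
  have hev : (fun y => (fderiv ℝ V y (EuclideanSpace.single 2 1) 0 * fderiv ℝ V y (EuclideanSpace.single 0 1) 2 +
              fderiv ℝ V y (EuclideanSpace.single 2 1) 1 * fderiv ℝ V y (EuclideanSpace.single 1 1) 2) /
            (fderiv ℝ V y (EuclideanSpace.single 0 1) 2 ^ 2 + fderiv ℝ V y (EuclideanSpace.single 1 1) 2 ^ 2)) =ᶠ[𝓝 p]
      fun y => -2⁻¹ - ((y 0 - y 2) * (y 0 - y 2) + y 1 * y 1)⁻¹ := by
    filter_upwards [isOpen_halfspace.mem_nhds hp] with y hy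
    obtain ⟨-, -, -, h20, -, -, h21, h02, h12, -⟩ := entries V hV hy
    have hry : ((y 0 - y 2) * (y 0 - y 2) + y 1 * y 1) ≠ 0 := by
      have : 0 < y 1 * y 1 := by have hy' : 0 < y 1 := hy; positivity
      nlinarith [mul_self_nonneg (y 0 - y 2)]
    simp only [h20, h21, h02, h12]
    field_simp
    ring
  have hd := ((hasDerivAt_inv hr0).comp_hasFDerivAt p (hasFDerivAt_rsq p)).const_sub (-2⁻¹ : ℝ)
  have hd' : HasFDerivAt (fun y : EuclideanSpace ℝ (Fin 3) => -2⁻¹ - ((y 0 - y 2) * (y 0 - y 2) + y 1 * y 1)⁻¹) _ p := hd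
  rw [hev.fderiv_eq, hd'.fderiv]
  constructor
  · simp; field_simp; ring
  · simp; field_simp; ring

/-- **The germ is real-analytic** on `{y > 0}`. -/
theorem analyticAt_germ (V : EuclideanSpace ℝ (Fin 3) → EuclideanSpace ℝ (Fin 3))
    (hV : V = fun p : EuclideanSpace ℝ (Fin 3) =>
      (p 0 * p 0 - p 0 * p 2 + 2⁻¹ * (p 2 * p 2) + Real.log ((p 0 - p 2) * (p 0 - p 2) + p 1 * p 1)) • EuclideanSpace.single (0 : Fin 3) (1 : ℝ) +
        (-(p 1 * p 2) + 2 * Real.arctan ((p 0 - p 2) * (p 1)⁻¹)) • EuclideanSpace.single (1 : Fin 3) (1 : ℝ) +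
        ((p 0 - p 2) * (p 0 - p 2) + p 1 * p 1) • EuclideanSpace.single (2 : Fin 3) (1 : ℝ)) {p : EuclideanSpace ℝ (Fin 3)} (hp : 0 < p 1) : AnalyticAt ℝ V p := by
  subst hV
  have a0 : AnalyticAt ℝ (fun y : EuclideanSpace ℝ (Fin 3) => y 0) p := (EuclideanSpace.proj (𝕜 := ℝ) (0 : Fin 3) : EuclideanSpace ℝ (Fin 3) →L[ℝ] ℝ).analyticAt p
  have a1 : AnalyticAt ℝ (fun y : EuclideanSpace ℝ (Fin 3) => y 1) p := (EuclideanSpace.proj (𝕜 := ℝ) (1 : Fin 3) : EuclideanSpace ℝ (Fin 3) →L[ℝ] ℝ).analyticAt p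
  have a2 : AnalyticAt ℝ (fun y : EuclideanSpace ℝ (Fin 3) => y 2) p := (EuclideanSpace.proj (𝕜 := ℝ) (2 : Fin 3) : EuclideanSpace ℝ (Fin 3) →L[ℝ] ℝ).analyticAt p
  have ar : AnalyticAt ℝ (fun y : EuclideanSpace ℝ (Fin 3) => (y 0 - y 2) * (y 0 - y 2) + y 1 * y 1) p :=
    ((a0.sub a2).mul (a0.sub a2)).add (a1.mul a1)
  have hr : 0 < ((p 0 - p 2) * (p 0 - p 2) + p 1 * p 1) := by
    have : 0 < p 1 * p 1 := by positivity
    nlinarith [mul_self_nonneg (p 0 - p 2)]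
  have alog : AnalyticAt ℝ (fun y : EuclideanSpace ℝ (Fin 3) => Real.log ((y 0 - y 2) * (y 0 - y 2) + y 1 * y 1)) p :=
    (analyticAt_log hr).comp_of_eq ar rfl
  have aat : AnalyticAt ℝ Real.arctan ((p 0 - p 2) * (p 1)⁻¹) := (Real.contDiff_arctan (n := ⊤)).contDiffAt.analyticAt
  have aq : AnalyticAt ℝ (fun y : EuclideanSpace ℝ (Fin 3) => (y 0 - y 2) * (y 1)⁻¹) p := (a0.sub a2).mul (a1.inv (ne_of_gt hp))
  have aatan : AnalyticAt ℝ (fun y : EuclideanSpace ℝ (Fin 3) => Real.arctan ((y 0 - y 2) * (y 1)⁻¹)) p :=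
    aat.comp_of_eq aq rfl
  have F0 : AnalyticAt ℝ (fun y : EuclideanSpace ℝ (Fin 3) => y 0 * y 0 - y 0 * y 2 + 2⁻¹ * (y 2 * y 2) +
      Real.log ((y 0 - y 2) * (y 0 - y 2) + y 1 * y 1)) p :=
    (((a0.mul a0).sub (a0.mul a2)).add (analyticAt_const.mul (a2.mul a2))).add alog
  have F1 : AnalyticAt ℝ (fun y : EuclideanSpace ℝ (Fin 3) => -(y 1 * y 2) + 2 * Real.arctan ((y 0 - y 2) * (y 1)⁻¹)) p :=
    (a1.mul a2).neg.add (analyticAt_const.mul aatan)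
  exact ((F0.smul analyticAt_const).add (F1.smul analyticAt_const)).add (ar.smul analyticAt_const)

/-- **The germ is time–height on NO open subset of `ℝ × {y > 0}`.** -/
theorem not_timeHeight (V : EuclideanSpace ℝ (Fin 3) → EuclideanSpace ℝ (Fin 3))
    (hV : V = fun p : EuclideanSpace ℝ (Fin 3) =>
      (p 0 * p 0 - p 0 * p 2 + 2⁻¹ * (p 2 * p 2) + Real.log ((p 0 - p 2) * (p 0 - p 2) + p 1 * p 1)) • EuclideanSpace.single (0 : Fin 3) (1 : ℝ) +
        (-(p 1 * p 2) + 2 * Real.arctan ((p 0 - p 2) * (p 1)⁻¹)) • EuclideanSpace.single (1 : Fin 3) (1 : ℝ) +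
        ((p 0 - p 2) * (p 0 - p 2) + p 1 * p 1) • EuclideanSpace.single (2 : Fin 3) (1 : ℝ)) (U₁ : Set (ℝ × EuclideanSpace ℝ (Fin 3)))
    (hU₁ : U₁ ⊆ {q | 0 < q.2 1}) (hU₁o : IsOpen U₁) (hU₁ne : U₁.Nonempty) (m : ℝ → ℝ → ℝ) :
    ∃ p ∈ U₁, ∃ b : Fin 3, b ≠ 2 ∧
      fderiv ℝ V p.2 (EuclideanSpace.single 2 1) b ≠ m p.1 (p.2 2) * fderiv ℝ V p.2 (EuclideanSpace.single b 1) 2 := by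
  obtain ⟨p, hp⟩ := hU₁ne
  have hp1 : 0 < p.2 1 := hU₁ hp
  obtain ⟨ε, hε, hball⟩ := Metric.isOpen_iff.1 hU₁o p hp
  set p' : ℝ × EuclideanSpace ℝ (Fin 3) := (p.1, p.2 + (ε / 2) • EuclideanSpace.single 1 (1 : ℝ)) with hp'
  have hp'U₁ : p' ∈ U₁ := by
    refine hball ?_
    rw [mem_ball, hp', Prod.dist_eq, dist_self, dist_eq_norm, add_sub_cancel_left, norm_smul]
    have h1 : ‖(EuclideanSpace.single 1 (1 : ℝ) : EuclideanSpace ℝ (Fin 3))‖ = 1 := by simp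
    rw [h1, mul_one, Real.norm_eq_abs, abs_of_pos (by linarith)]
    exact max_lt hε (by linarith)
  have c0 : p'.2 0 = p.2 0 := by simp [hp']
  have c1 : p'.2 1 = p.2 1 + ε / 2 := by simp [hp']
  have c2 : p'.2 2 = p.2 2 := by simp [hp']
  have c3 : p'.1 = p.1 := rfl
  have hp1' : 0 < p'.2 1 := by rw [c1]; linarith
  by_contra hno
  push Not at hno
  have e1 := hno p hp 1 (by decide)
  have e2 := hno p' hp'U₁ 1 (by decide)
  obtain ⟨-, -, -, -, -, -, h21, -, h12, -⟩ := entries V hV hp1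
  obtain ⟨-, -, -, -, -, -, h21', -, h12', -⟩ := entries V hV hp1'
  rw [h21, h12] at e1
  rw [h21', h12', c0, c1, c2, c3] at e2
  clear h21 h12 h21' h12' hno hball hp'U₁ hp1' c0 c1 c2 c3 hU₁ hp hV
  clear_value p'
  clear hp' p'
  set y := p.2 1 with hy
  set a := p.2 0 - p.2 2 with ha
  set M := m p.1 (p.2 2) with hM
  have ha2 := mul_self_nonneg a
  have hyy := mul_pos hp1 hp1
  have hS1 : 0 < a * a + y * y := by linarith
  have hyε : 0 < y + ε / 2 := by linarith
  have hyε2 := mul_pos hyε hyε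
  have hS2 : 0 < a * a + (y + ε / 2) * (y + ε / 2) := by linarith
  have k1 : (2 * M + 1) * (a * a + y * y) = -2 := by
    have t0 : 2 * y / (a * a + y * y) = -y - M * (2 * y) := by linarith [e1]
    rw [div_eq_iff (ne_of_gt hS1)] at t0
    have t1 : y * ((2 * M + 1) * (a * a + y * y) + 2) = 0 := by linear_combination t0
    have t2 := (mul_eq_zero.1 t1).resolve_left (ne_of_gt hp1)
    linarith
  have k2 : (2 * M + 1) * (a * a + (y + ε / 2) * (y + ε / 2)) = -2 := by
    have t0 : 2 * (y + ε / 2) / (a * a + (y + ε / 2) * (y + ε / 2)) = -(y + ε / 2) - M * (2 * (y + ε / 2)) := by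
      linarith [e2]
    rw [div_eq_iff (ne_of_gt hS2)] at t0
    have t1 : (y + ε / 2) * ((2 * M + 1) * (a * a + (y + ε / 2) * (y + ε / 2)) + 2) = 0 := by linear_combination t0
    have t2 := (mul_eq_zero.1 t1).resolve_left (ne_of_gt hyε)
    linarith
  have hne : (2 * M + 1) ≠ 0 := by
    intro h0; rw [h0, zero_mul] at k1; norm_num at k1
  have hRR : a * a + y * y = a * a + (y + ε / 2) * (y + ε / 2) := mul_left_cancel₀ hne (k1.trans k2.symm)
  have h5 : ε * (y + ε / 4) = 0 := by linear_combination (-1 : ℝ) * hRR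
  rcases mul_eq_zero.1 h5 with h | h
  · linarith
  · linarith

/-! ### The packaged statement -/

/-- **The log-twist germ: all kinematic hypotheses of the local THICK statements (`hopen`, `hthick`, `hleaf`), and «time–height on NO open
subset», hold simultaneously** for some real-analytic `u` on some nonempty open space–time set (the steady germ of the module docstring on
`ℝ × {y > 0}`). -/
theorem logTwistGerm_hypotheses :
    ∃ (u : ℝ → EuclideanSpace ℝ (Fin 3) → EuclideanSpace ℝ (Fin 3)) (U : Set (ℝ × EuclideanSpace ℝ (Fin 3))),
      IsOpen U ∧ U.Nonempty ∧ AnalyticOnNhd ℝ (Function.uncurry u) U ∧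
      (∀ p ∈ U, ⟪Literature.Analysis.FluidPDE.curl (u p.1) p.2, EuclideanSpace.single 2 1⟫_ℝ = 0) ∧
      (∀ p ∈ U, fderiv ℝ (u p.1) p.2 (EuclideanSpace.single 2 1) 0 * fderiv ℝ (u p.1) p.2 (EuclideanSpace.single 1 1) 2 =
        fderiv ℝ (u p.1) p.2 (EuclideanSpace.single 2 1) 1 * fderiv ℝ (u p.1) p.2 (EuclideanSpace.single 0 1) 2) ∧
      (∀ p ∈ U, Literature.Analysis.FluidPDE.curl (u p.1) p.2 ≠ 0 ∧
        (fderiv ℝ (u p.1) p.2 (EuclideanSpace.single 0 1) 2 ≠ 0 ∨ fderiv ℝ (u p.1) p.2 (EuclideanSpace.single 1 1) 2 ≠ 0) ∧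
        (fderiv ℝ (u p.1) p.2 (EuclideanSpace.single 2 1) 0 ≠ 0 ∨ fderiv ℝ (u p.1) p.2 (EuclideanSpace.single 2 1) 1 ≠ 0)) ∧
      (∀ p ∈ U,
        fderiv ℝ (fun y => fderiv ℝ (u p.1) y (EuclideanSpace.single 2 1) 2) p.2 (EuclideanSpace.single 0 1) *
            fderiv ℝ (u p.1) p.2 (EuclideanSpace.single 1 1) 2 -
          fderiv ℝ (fun y => fderiv ℝ (u p.1) y (EuclideanSpace.single 2 1) 2) p.2 (EuclideanSpace.single 1 1) *
            fderiv ℝ (u p.1) p.2 (EuclideanSpace.single 0 1) 2 ≠ 0) ∧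
      (∀ p ∈ U, fderiv ℝ (u p.1) p.2 (EuclideanSpace.single 2 1) 0 * fderiv ℝ (u p.1) p.2 (EuclideanSpace.single 0 1) 2 +
          fderiv ℝ (u p.1) p.2 (EuclideanSpace.single 2 1) 1 * fderiv ℝ (u p.1) p.2 (EuclideanSpace.single 1 1) 2 < 0) ∧
      (∀ p ∈ U,
        fderiv ℝ (fun y => (fderiv ℝ (u p.1) y (EuclideanSpace.single 2 1) 0 * fderiv ℝ (u p.1) y (EuclideanSpace.single 0 1) 2 +
              fderiv ℝ (u p.1) y (EuclideanSpace.single 2 1) 1 * fderiv ℝ (u p.1) y (EuclideanSpace.single 1 1) 2) /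
            (fderiv ℝ (u p.1) y (EuclideanSpace.single 0 1) 2 ^ 2 + fderiv ℝ (u p.1) y (EuclideanSpace.single 1 1) 2 ^ 2)) p.2 (EuclideanSpace.single 0 1) ≠ 0 ∨
        fderiv ℝ (fun y => (fderiv ℝ (u p.1) y (EuclideanSpace.single 2 1) 0 * fderiv ℝ (u p.1) y (EuclideanSpace.single 0 1) 2 +
              fderiv ℝ (u p.1) y (EuclideanSpace.single 2 1) 1 * fderiv ℝ (u p.1) y (EuclideanSpace.single 1 1) 2) /
            (fderiv ℝ (u p.1) y (EuclideanSpace.single 0 1) 2 ^ 2 + fderiv ℝ (u p.1) y (EuclideanSpace.single 1 1) 2 ^ 2)) p.2 (EuclideanSpace.single 1 1) ≠ 0) ∧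
      (∀ p ∈ U,
        fderiv ℝ (fun y => (fderiv ℝ (u p.1) y (EuclideanSpace.single 2 1) 0 * fderiv ℝ (u p.1) y (EuclideanSpace.single 0 1) 2 +
              fderiv ℝ (u p.1) y (EuclideanSpace.single 2 1) 1 * fderiv ℝ (u p.1) y (EuclideanSpace.single 1 1) 2) /
            (fderiv ℝ (u p.1) y (EuclideanSpace.single 0 1) 2 ^ 2 + fderiv ℝ (u p.1) y (EuclideanSpace.single 1 1) 2 ^ 2)) p.2 (EuclideanSpace.single 0 1) * fderiv ℝ (u p.1) p.2 (EuclideanSpace.single 1 1) 2 =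
        fderiv ℝ (fun y => (fderiv ℝ (u p.1) y (EuclideanSpace.single 2 1) 0 * fderiv ℝ (u p.1) y (EuclideanSpace.single 0 1) 2 +
              fderiv ℝ (u p.1) y (EuclideanSpace.single 2 1) 1 * fderiv ℝ (u p.1) y (EuclideanSpace.single 1 1) 2) /
            (fderiv ℝ (u p.1) y (EuclideanSpace.single 0 1) 2 ^ 2 + fderiv ℝ (u p.1) y (EuclideanSpace.single 1 1) 2 ^ 2)) p.2 (EuclideanSpace.single 1 1) * fderiv ℝ (u p.1) p.2 (EuclideanSpace.single 0 1) 2) ∧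
      (∀ p ∈ U,
        fderiv ℝ (fun y => (fderiv ℝ (u p.1) y (EuclideanSpace.single 2 1) 0 * fderiv ℝ (u p.1) y (EuclideanSpace.single 0 1) 2 +
              fderiv ℝ (u p.1) y (EuclideanSpace.single 2 1) 1 * fderiv ℝ (u p.1) y (EuclideanSpace.single 1 1) 2) /
            (fderiv ℝ (u p.1) y (EuclideanSpace.single 0 1) 2 ^ 2 + fderiv ℝ (u p.1) y (EuclideanSpace.single 1 1) 2 ^ 2)) p.2 (EuclideanSpace.single 0 1) * fderiv ℝ (u p.1) p.2 (EuclideanSpace.single 0 1) 2 +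
        fderiv ℝ (fun y => (fderiv ℝ (u p.1) y (EuclideanSpace.single 2 1) 0 * fderiv ℝ (u p.1) y (EuclideanSpace.single 0 1) 2 +
              fderiv ℝ (u p.1) y (EuclideanSpace.single 2 1) 1 * fderiv ℝ (u p.1) y (EuclideanSpace.single 1 1) 2) /
            (fderiv ℝ (u p.1) y (EuclideanSpace.single 0 1) 2 ^ 2 + fderiv ℝ (u p.1) y (EuclideanSpace.single 1 1) 2 ^ 2)) p.2 (EuclideanSpace.single 1 1) * fderiv ℝ (u p.1) p.2 (EuclideanSpace.single 1 1) 2 ≠ 0) ∧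
      (∀ U₁ : Set (ℝ × EuclideanSpace ℝ (Fin 3)), U₁ ⊆ U → IsOpen U₁ → U₁.Nonempty → ∀ m : ℝ → ℝ → ℝ,
        ∃ p ∈ U₁, ∃ b : Fin 3, b ≠ 2 ∧
          fderiv ℝ (u p.1) p.2 (EuclideanSpace.single 2 1) b ≠ m p.1 (p.2 2) * fderiv ℝ (u p.1) p.2 (EuclideanSpace.single b 1) 2) := by
  obtain ⟨V, hV⟩ : ∃ V : EuclideanSpace ℝ (Fin 3) → EuclideanSpace ℝ (Fin 3), V = fun p : EuclideanSpace ℝ (Fin 3) =>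
      (p 0 * p 0 - p 0 * p 2 + 2⁻¹ * (p 2 * p 2) + Real.log ((p 0 - p 2) * (p 0 - p 2) + p 1 * p 1)) • EuclideanSpace.single (0 : Fin 3) (1 : ℝ) +
        (-(p 1 * p 2) + 2 * Real.arctan ((p 0 - p 2) * (p 1)⁻¹)) • EuclideanSpace.single (1 : Fin 3) (1 : ℝ) +
        ((p 0 - p 2) * (p 0 - p 2) + p 1 * p 1) • EuclideanSpace.single (2 : Fin 3) (1 : ℝ) := ⟨_, rfl⟩
  refine ⟨fun _ => V, {q | 0 < q.2 1}, isOpen_lt continuous_const ((EuclideanSpace.proj (𝕜 := ℝ) (1 : Fin 3) : EuclideanSpace ℝ (Fin 3) →L[ℝ] ℝ).continuous.comp continuous_snd),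
    ⟨((0 : ℝ), EuclideanSpace.single 1 (1 : ℝ)), by simp⟩, fun q hq => (analyticAt_germ V hV hq).comp analyticAt_snd,
    fun q hq => ?_, fun q hq => ?_, fun q hq => ?_, fun q hq => ?_, fun q hq => ?_, fun q hq => ?_, fun q hq => ?_, fun q hq => ?_,
    fun U₁ hU₁ hU₁o hU₁ne m => not_timeHeight V hV U₁ hU₁ hU₁o hU₁ne m⟩
  all_goals
    have hq' : 0 < q.2 1 := hq
    have hqq : 0 < q.2 1 * q.2 1 := by positivity
    have hr : 0 < ((q.2 0 - q.2 2) * (q.2 0 - q.2 2) + q.2 1 * q.2 1) := by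
      nlinarith [mul_self_nonneg (q.2 0 - q.2 2)]
    have hr0 : ((q.2 0 - q.2 2) * (q.2 0 - q.2 2) + q.2 1 * q.2 1) ≠ 0 := ne_of_gt hr
    obtain ⟨-, h00, h10, h20, h01, h11, h21, h02, h12, h22⟩ := entries V hV hq'
  · -- poloidal
    have h : curl V q.2 2 = 0 := by rw [curl_apply_two_eq, h01, h10]; ring
    simpa [EuclideanSpace.inner_single_right] using h
  · -- frozen
    rw [h20, h21, h02, h12]; field_simp; ring
  · -- non-degenerate
    refine ⟨fun hc => ?_, Or.inr ?_, Or.inr ?_⟩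
    · have h0 : curl V q.2 0 = 0 := by rw [hc]; rfl
      rw [curl_apply_zero_eq, h12, h21] at h0
      have : 0 < 2 * q.2 1 / ((q.2 0 - q.2 2) * (q.2 0 - q.2 2) + q.2 1 * q.2 1) := by positivity
      linarith
    · rw [h12]; positivity
    · rw [h21]
      have : 0 < 2 * q.2 1 / ((q.2 0 - q.2 2) * (q.2 0 - q.2 2) + q.2 1 * q.2 1) := by positivity
      linarith
  · -- twist
    rw [(twist_entries V hV hq').1, (twist_entries V hV hq').2, h02, h12]
    nlinarith
  · -- hyperbolic
    have e : fderiv ℝ V q.2 (EuclideanSpace.single 2 1) 0 * fderiv ℝ V q.2 (EuclideanSpace.single 0 1) 2 +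
        fderiv ℝ V q.2 (EuclideanSpace.single 2 1) 1 * fderiv ℝ V q.2 (EuclideanSpace.single 1 1) 2 =
        -(2 * ((q.2 0 - q.2 2) * (q.2 0 - q.2 2) + q.2 1 * q.2 1)) - 4 := by
      rw [h20, h21, h02, h12]; field_simp; ring
    rw [e]; linarith
  · -- ∇ₕΛ ≠ 0
    rw [(ratio_entries V hV hq').2]
    exact Or.inr (by positivity)
  · -- leafwise
    rw [(ratio_entries V hV hq').1, (ratio_entries V hV hq').2, h02, h12]; ring
  · -- ∂ₙΛ ≠ 0
    rw [(ratio_entries V hV hq').1, (ratio_entries V hV hq').2, h02, h12]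
    have e : 2 * (q.2 0 - q.2 2) / ((q.2 0 - q.2 2) * (q.2 0 - q.2 2) + q.2 1 * q.2 1) ^ 2 * (2 * (q.2 0 - q.2 2)) +
        2 * q.2 1 / ((q.2 0 - q.2 2) * (q.2 0 - q.2 2) + q.2 1 * q.2 1) ^ 2 * (2 * q.2 1) = 4 / ((q.2 0 - q.2 2) * (q.2 0 - q.2 2) + q.2 1 * q.2 1) := by
      field_simp; ring
    rw [e]; positivity

end Summit.NavierStokesRegularity.NavierStokesRegularity.Theorems.PoloidalWindowRigidity.Negative.LogTwistGerm

end
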